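import Summits.AtomisticToContinuum.Crystallization.Theorems.OverbindingBudgetUniformCutPins

/-!
# OverbindingBudget — the uniform Liouville law in DENSITY form (decomp-a2c lens-4, generation 25; refinement of line v8 «UniformCut»)

Helper file (`--supports stmt-AtomisticToContinuum-31280`).  The blow-down `OverbindingBudgetUniformCutLimit.regU_of_liouU` uses the global
Liouville law `CleanLiouvilleU T₀ D` (LIOUᵘ: «a globally `T₀`-clean thin-cored `μ`-ground state is globally `t`-clean at some admissible
spacing, every `t > 0`») only through ONE consequence: the blow-down limit `Z`, which carries `t`-robust violators `L`-densely at EVERY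
admissible spacing, cannot also have a `t/2`-clean `L`-ball at some admissible spacing.  So the law the cone actually needs is the DENSITY form

* `CleanLiouvilleBallsU T₀ D` (LIOUBᵘ): a globally `RT a T₀`-clean, uniformly discrete, `9/10`-covering `μ`-ground state at a limiting
  density, with loosened thin cores of radius `D` at an admissible host spacing, has — for every `t > 0` and every radius `L` — an `L`-ball
  that is `RT a' t`-clean at SOME admissible spacing `a'`.

This is WEAKER than LIOUᵘ (`liouBallsU_of_liouU`: a globally clean texture is clean on every ball) and tolerates non-dense defects of the
globally clean texture (isolated edge-hugging sites, sparse strain concentrations), which LIOUᵘ does not; and it gives the same uniform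
ε-regularity (`regU_of_liouBallsU`, the proof of `regU_of_liouU` verbatim up to its last three lines), hence the same cones:
`mcbU_of_grossU_liouBallsU`, `rdef_of_grossU_liouBallsU_coherent` (`GrossCleanBallsU T₀ 10 → CleanLiouvilleBallsU T₀ 10 → CleanlessExcessT →
CoherentResidual 10 → RobustDefectLimitWindows`, `T₀ > 0`).  The record pin `cleanLiouvilleBallsU_record_iff` displays LIOUBᵘ(1/250) 10 as a
self-contained text (same conventions as `OverbindingBudgetUniformCutPins`).  The registered v8 stub `stub_cleanLiouvilleU` is untouched
(registry freeze); this file only records that its density weakening already suffices.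
-/

namespace Summit.AtomisticToContinuum.Crystallization.Theorems.OverbindingBudgetUniformCutDensity

open Filter Metric Set Topology
open scoped BigOperators
open Literature.MathematicalPhysics.StatisticalMechanics
open Summit.AtomisticToContinuum.Crystallization.Theses.OverbindingBudget (RobustDefectLimitWindows)
open Summit.AtomisticToContinuum.Crystallization.Theorems.OverbindingBudgetViolatorDensityFloor (GT RT)
open Summit.AtomisticToContinuum.Crystallization.Theorems.OverbindingBudgetWallTensionLever (ThinCores)
open Summit.AtomisticToContinuum.Crystallization.Theorems.OverbindingBudgetGradedBareness (CleanlessExcessT)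
open Summit.AtomisticToContinuum.Crystallization.Theorems.OverbindingBudgetCoherentCut (CoherentResidual)
open Summit.AtomisticToContinuum.Crystallization.Theorems.OverbindingBudgetMatchCompactness (exists_subseq_forall_eventually_match)
open Summit.AtomisticToContinuum.Crystallization.Theorems.OverbindingBudgetRecurrentSealStatements (sep_translate solid_translate
  translate_translate)
open Summit.AtomisticToContinuum.Crystallization.Theorems.OverbindingBudgetRecurrentSealClosure (solid_of_limit)
open Summit.AtomisticToContinuum.Crystallization.Theorems.OverbindingBudgetRecurrentDustStatements (ThinCoresL ViolatorsL window_finite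
  window_finite_lt rt_mono thinCoresL_of_thinCores thinCoresL_translate rt_translate)
open Summit.AtomisticToContinuum.Crystallization.Theorems.OverbindingBudgetRecurrentDustClosure (norm_le_of_dist_le rt_of_match
  thinCoresL_of_limit)
open Summit.AtomisticToContinuum.Crystallization.Theorems.OverbindingBudgetRegularityCutLimit (isMuGSC_translate violatorsL_of_limit_local)
open Summit.AtomisticToContinuum.Crystallization.Theorems.OverbindingBudgetMuGSCLimit (muGSCLimitClosed)
open Summit.AtomisticToContinuum.Crystallization.Theorems.OverbindingBudgetUniformCutStatements

open Summit.AtomisticToContinuum.Crystallization.Theorems.OverbindingBudgetUniformCutLimit (rtAbove_of_limit_spacing rt_of_rtAbove)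

/-! ## §A  The density form of the uniform Liouville law -/

/-- **`CleanLiouvilleBallsU T₀ D`** (LIOUBᵘ) — a uniformly discrete `9/10`-covering (closed form) `μ`-ground state at a limiting density
`e`, with loosened thin cores of radius `D` at an admissible host spacing `b`, which passes the relaxed test `RT a T₀` at EVERY site at an
admissible spacing `a`, has for every `t > 0` and every `L` an `L`-ball `B(q, L)`, `q ∈ Y`, all of whose sites pass `RT a' t` at SOME
admissible spacing `a'`.  The density weakening of `CleanLiouvilleU T₀ D`. -/
def CleanLiouvilleBallsU (T₀ D : ℝ) : Prop :=
  ∀ e : ℝ, Filter.Tendsto (fun N : ℕ => groundStateEnergy lennardJones 3 N / N) Filter.atTop (nhds e) →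
    (∀ N : ℕ, 0 < N → e ≤ groundStateEnergy lennardJones 3 N / N) →
    ∀ Y : Set (EuclideanSpace ℝ (Fin 3)), UniformlyDiscrete Y → (∀ z : EuclideanSpace ℝ (Fin 3), ∃ w ∈ Y, dist z w ≤ 9 / 10) →
      IsMuGSC lennardJones e Y → ∀ b : ℝ, 47 / 50 ≤ b → b ≤ 1 → ThinCoresL b D Y →
      ∀ a : ℝ, 47 / 50 ≤ a → a ≤ 1 → (∀ y ∈ Y, RT a T₀ Y y) →
        ∀ t : ℝ, 0 < t → ∀ L : ℝ, ∃ a' : ℝ, 47 / 50 ≤ a' ∧ a' ≤ 1 ∧ ∃ q ∈ Y, ∀ y ∈ Y, dist y q ≤ L → RT a' t Y y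

/-- **LIOUᵘ ⇒ LIOUBᵘ**: a globally `t`-clean texture is `t`-clean on every ball (a centre exists by the covering hypothesis). [this file] -/
theorem liouBallsU_of_liouU {T₀ D : ℝ} (h : CleanLiouvilleU T₀ D) : CleanLiouvilleBallsU T₀ D := by
  intro e hT hlb Y hUD hcov hμ b hb1 hb2 hthin a ha1 ha2 hclean t ht L
  obtain ⟨a', ha1', ha2', hall⟩ := h e hT hlb Y hUD hcov hμ b hb1 hb2 hthin a ha1 ha2 hclean t ht
  obtain ⟨w, hw, -⟩ := hcov 0
  exact ⟨a', ha1', ha2', w, hw, fun y hy _ => hall y hy⟩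

/-- Monotonicity of LIOUBᵘ in the core radius (a larger core radius is a weaker hypothesis on the texture). [this file] -/
theorem liouBallsU_mono_radius {T₀ D D' : ℝ} (hDD : D ≤ D') (h : CleanLiouvilleBallsU T₀ D') : CleanLiouvilleBallsU T₀ D := by
  intro e hT hlb Y hUD hcov hμ b hb1 hb2 hthin
  refine h e hT hlb Y hUD hcov hμ b hb1 hb2 ?_
  intro z
  obtain ⟨y, hy, hd, hc⟩ := hthin z
  exact ⟨y, hy, hd.trans hDD, hc⟩

/-! ## §B  The blow-down from the density form -/

/-- **The blow-down, spacing-uniformly, from the density form.**  `CleanLiouvilleBallsU T₀ D → CleanRegularityU T₀ D` (`0 ≤ T₀`):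
the proof of `OverbindingBudgetUniformCutLimit.regU_of_liouU` verbatim (re-rooting, convergent clean spacings by compactness of
`[47/50, 1]`, two-way matched subsequence and limit `Z`, closure of covering / `μ`-GSC / loosened thin cores / global `T₀`-cleanness /
`L`-dense `t`-robust violators at every admissible spacing), except the last step: LIOUBᵘ gives ONE `t/2`-clean `L`-ball of `Z` at some
admissible `a'`, and the `L`-dense violators at that `a'` put a `t`-robust violator inside it. [this file] -/
theorem regU_of_liouBallsU {T₀ D : ℝ} (hT₀ : 0 ≤ T₀) (hL : CleanLiouvilleBallsU T₀ D) : CleanRegularityU T₀ D := by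
  classical
  intro e hT hlb δ hδ b hb1 hb2 t ht ht1 L
  by_contra hno
  push Not at hno
  choose Y hsepY hcovY hμY hthinY a ha1 ha2 q hq hcleanY hviolY using fun n : ℕ => hno (n : ℝ)
  -- re-root at the centres of the clean balls
  set Zs : ℕ → Set (EuclideanSpace ℝ (Fin 3)) := fun n => (fun p => p - q n) '' Y n with hZs
  have hsepk : ∀ n, ∀ p ∈ Zs n, ∀ p' ∈ Zs n, p ≠ p' → δ ≤ dist p p' := fun n => sep_translate (q n) (hsepY n)
  have hsolidk : ∀ n, ∀ z : EuclideanSpace ℝ (Fin 3), ∃ w ∈ Zs n, dist z w ≤ 9 / 10 := fun n =>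
    solid_translate (q n) fun z =>
      let ⟨w, hw, hd⟩ := hcovY n z
      ⟨w, hw, hd.le⟩
  have hμk : ∀ n, IsMuGSC lennardJones e (Zs n) := fun n => isMuGSC_translate ⟨δ, hδ, hsepY n⟩ (hμY n) (q n)
  have hthink : ∀ n, ThinCoresL b D (Zs n) := fun n => thinCoresL_translate (q n) (thinCoresL_of_thinCores hb1 (hthinY n))
  have hcleank : ∀ n, ∀ y ∈ Zs n, ‖y‖ ≤ (n : ℝ) → RT (a n) T₀ (Zs n) y := by
    rintro n _ ⟨p, hp, rfl⟩ hn
    have hd : dist p (q n) ≤ n := by rwa [dist_eq_norm]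
    exact rt_translate (q n) (hcleanY n p hp hd)
  have hviolk : ∀ n, ∀ a' : ℝ, 47 / 50 ≤ a' → a' ≤ 1 → ∀ q' ∈ Zs n, ‖q'‖ ≤ (n : ℝ) →
      ∃ y ∈ Zs n, dist y q' ≤ L ∧ ∀ s : ℝ, 0 < s → s < t → ¬ RT a' s (Zs n) y := by
    rintro n a' ha1' ha2' _ ⟨p', hp', rfl⟩ hn
    have hd : dist p' (q n) ≤ n := by rwa [dist_eq_norm]
    obtain ⟨y, hy, hyd, hyn⟩ := hviolY n a' ha1' ha2' p' hp' hd
    refine ⟨y - q n, ⟨y, hy, rfl⟩, by rwa [dist_sub_right], fun s hs hst hRT => hyn ?_⟩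
    have h1 := rt_translate (-q n) hRT
    rw [translate_translate, sub_neg_eq_add, sub_add_cancel] at h1
    exact rt_mono ⟨δ, hδ, hsepY n⟩ hst.le h1
  -- a subsequence along which the clean spacings converge
  obtain ⟨alim, halim, φ₁, hφ₁, hlim₁⟩ :=
    (isCompact_Icc : IsCompact (Set.Icc (47 / 50 : ℝ) 1)).tendsto_subseq (x := a) fun n => ⟨ha1 n, ha2 n⟩
  obtain ⟨hal1, hal2⟩ := halim
  -- a two-way locally matched subsequence and its limit
  obtain ⟨φ₂, Z, hφ₂, hZsep, hconv⟩ := exists_subseq_forall_eventually_match hδ (fun k => Zs (φ₁ k)) fun k => hsepk (φ₁ k)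
  have hconv' : ∀ R ε : ℝ, 0 < ε → ∀ᶠ k in atTop, Match ε R 0 (Zs (φ₁ (φ₂ k))) Z := hconv
  have hψ : StrictMono (fun k => φ₁ (φ₂ k)) := hφ₁.comp hφ₂
  have hρ : Tendsto (fun k : ℕ => ((φ₁ (φ₂ k) : ℕ) : ℝ)) atTop atTop := tendsto_natCast_atTop_atTop.comp hψ.tendsto_atTop
  have has : Tendsto (fun k => a (φ₁ (φ₂ k))) atTop (𝓝 alim) := hlim₁.comp hφ₂.tendsto_atTop
  have hZsolid : ∀ z : EuclideanSpace ℝ (Fin 3), ∃ w ∈ Z, dist z w ≤ 9 / 10 :=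
    solid_of_limit hδ hZsep hconv' fun k => hsolidk (φ₁ (φ₂ k))
  have hZμ : IsMuGSC lennardJones e Z :=
    muGSCLimitClosed e δ hδ (fun k => Zs (φ₁ (φ₂ k))) Z (fun k => hsepk (φ₁ (φ₂ k))) (fun k => hμk (φ₁ (φ₂ k))) hZsep hconv'
  have hZthin : ThinCoresL b D Z :=
    thinCoresL_of_limit hδ hb1 hb2 (fun k => hsepk (φ₁ (φ₂ k))) hZsep hconv' fun k => hthink (φ₁ (φ₂ k))
  have hZclean : ∀ y' ∈ Z, ∀ s : ℝ, T₀ < s → RT alim s Z y' :=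
    rtAbove_of_limit_spacing hδ hal1 hal2 hT₀ (fun k => hsepk (φ₁ (φ₂ k))) hZsep hconv' hρ has fun k => hcleank (φ₁ (φ₂ k))
  have hZviol : ∀ a' : ℝ, 47 / 50 ≤ a' → a' ≤ 1 → ViolatorsL a' t L Z := fun a' ha1' ha2' =>
    violatorsL_of_limit_local hδ ha1' ha2' (fun k => hsepk (φ₁ (φ₂ k))) hZsep hconv' hρ fun k => hviolk (φ₁ (φ₂ k)) a' ha1' ha2'
  -- the density Liouville statement gives one clean ball of the limit; the dense violators sit inside it
  obtain ⟨a', ha1', ha2', q₀, hq₀, hall⟩ := hL e hT hlb Z ⟨δ, hδ, hZsep⟩ hZsolid hZμ b hb1 hb2 hZthin alim hal1 hal2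
    (fun y hy => rt_of_rtAbove ⟨δ, hδ, hZsep⟩ (hZclean y hy)) (t / 2) (by linarith) L
  obtain ⟨y, hy, hyd, hn⟩ := hZviol a' ha1' ha2' q₀ hq₀
  exact hn (t / 2) (by linarith) (by linarith) (hall y hy hyd)

/-! ## §C  The cones from the density form -/

/-- **The uniform cut, blown down from the density form.**  `GrossCleanBallsU T₀ D → CleanLiouvilleBallsU T₀ D → MuCleanBallsU D` (`0 < T₀`). [this file] -/
theorem mcbU_of_grossU_liouBallsU {T₀ D : ℝ} (hT : 0 < T₀) (hG : GrossCleanBallsU T₀ D) (hL : CleanLiouvilleBallsU T₀ D) :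
    MuCleanBallsU D :=
  mcbU_of_grossU_softU hG (softU_of_regU (regU_of_liouBallsU hT.le hL))

/-- **The cone with the density form.**  `GrossCleanBallsU T₀ 10 → CleanLiouvilleBallsU T₀ 10 → CleanlessExcessT → CoherentResidual 10 →
RobustDefectLimitWindows` for `T₀ > 0` — the cone of record `rdef_of_grossU_liouU_coherent` with its second law WEAKENED to density form. [this file] -/
theorem rdef_of_grossU_liouBallsU_coherent {T₀ : ℝ} (hT : 0 < T₀) (hG : GrossCleanBallsU T₀ 10) (hL : CleanLiouvilleBallsU T₀ 10)
    (hCE : CleanlessExcessT) (hR : CoherentResidual 10) : RobustDefectLimitWindows :=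
  rdef_of_mcbU_coherent (mcbU_of_grossU_liouBallsU hT hG hL) hCE hR

/-! ## §D  Record pin of the density form -/

/-- **Pin of LIOUBᵘ at the record numerals** `(1/250, 10)`, fully expanded (conventions of `OverbindingBudgetUniformCutPins`). [this file] -/
theorem cleanLiouvilleBallsU_record_iff :
    CleanLiouvilleBallsU (1 / 250) 10 ↔
    (∀ e : ℝ, Filter.Tendsto (fun N : ℕ => Literature.MathematicalPhysics.StatisticalMechanics.groundStateEnergy Literature.MathematicalPhysics.StatisticalMechanics.lennardJones 3 N / N) Filter.atTop (nhds e) → (∀ N : ℕ, 0 < N → e ≤ Literature.MathematicalPhysics.StatisticalMechanics.groundStateEnergy Literature.MathematicalPhysics.StatisticalMechanics.lennardJones 3 N / N) → ∀ Y : Set (EuclideanSpace ℝ (Fin 3)), Literature.MathematicalPhysics.StatisticalMechanics.UniformlyDiscrete Y → (∀ z : EuclideanSpace ℝ (Fin 3), ∃ w ∈ Y, dist z w ≤ 9 / 10) → Literature.MathematicalPhysics.StatisticalMechanics.IsMuGSC Literature.MathematicalPhysics.StatisticalMechanics.lennardJones e Y → ∀ b : ℝ, 47 / 50 ≤ b →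 b ≤ 1 → (∀ z : EuclideanSpace ℝ (Fin 3), ∃ y ∈ Y, dist z y ≤ 10 ∧ ∀ s : ℝ, 0 < s → s < 1 / 100 → ({w ∈ Y | w ≠ y ∧ dist y w ≤ b * (1 + 1 / 50) + s}.ncard = 12 ∧ (∀ w ∈ Y, w ≠ y → b * (1 - 1 / 50) - s ≤ dist y w ∧ (dist y w ≤ b * (1 + 1 / 50) + s ∨ b * (63 / 50) - s ≤ dist y w)) ∧ (∃ T : Finset (EuclideanSpace ℝ (Fin 3)), (↑T : Set (EuclideanSpace ℝ (Fin 3))) = (fun w => b⁻¹ • (w - y)) '' {w ∈ Y | w ≠ y ∧ dist y w ≤ b * (1 + 1 / 50)} ∧ (Literature.Geometry.DiscreteGeometry.ShellCloseTo (1 / 5 + s) T Literature.Geometry.DiscreteGeometry.fccKissingPattern ∨ Literature.Geometry.DiscreteGeometry.ShellCloseTo (1 / 5 + s) T Literature.Geometry.DiscreteGeometry.hcpKissingPattern)))) → ∀ a : ℝ, 47 / 50 ≤ a → a ≤ 1 → (∀ y ∈ Y, ({w ∈ Y | w ≠ y ∧ dist y w < a * (63 / 50) - 1 / 250}.ncard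 ≤ 12 ∧ 12 ≤ {w ∈ Y | w ≠ y ∧ dist y w ≤ a * (1 + 1 / 50) + 1 / 250}.ncard ∧ ∀ w ∈ Y, w ≠ y → a * (1 - 1 / 50) - 1 / 250 ≤ dist y w ∧ (dist y w ≤ a * (1 + 1 / 50) + 1 / 250 ∨ a * (63 / 50) - 1 / 250 ≤ dist y w))) → ∀ t : ℝ, 0 < t → ∀ L : ℝ, ∃ a' : ℝ, 47 / 50 ≤ a' ∧ a' ≤ 1 ∧ ∃ q ∈ Y, ∀ y ∈ Y, dist y q ≤ L → ({w ∈ Y | w ≠ y ∧ dist y w < a' * (63 / 50) - t}.ncard ≤ 12 ∧ 12 ≤ {w ∈ Y | w ≠ y ∧ dist y w ≤ a' * (1 + 1 / 50) + t}.ncard ∧ ∀ w ∈ Y, w ≠ y → a' * (1 - 1 / 50) - t ≤ dist y w ∧ (dist y w ≤ a' * (1 + 1 / 50) + t ∨ a' * (63 / 50) - t ≤ dist y w))) := by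
  unfold CleanLiouvilleBallsU
    Summit.AtomisticToContinuum.Crystallization.Theorems.OverbindingBudgetRecurrentDustStatements.ThinCoresL
    Summit.AtomisticToContinuum.Crystallization.Theorems.OverbindingBudgetWallTensionLever.CleanT
    Summit.AtomisticToContinuum.Crystallization.Theorems.OverbindingBudgetViolatorDensityFloor.RT
  simp only [sub_neg_eq_add, ← sub_eq_add_neg]

/-- **The cone of record over texts, density form**: the expanded texts of GROSSᵘ(1/250) 10 and LIOUBᵘ(1/250) 10 with the generation-17/19
laws give `RobustDefectLimitWindows`. [this file] -/
theorem rdef_of_record_texts_density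
    (hG : GrossCleanBallsU (1 / 250) 10)
    (hL : ∀ e : ℝ, Filter.Tendsto (fun N : ℕ => Literature.MathematicalPhysics.StatisticalMechanics.groundStateEnergy Literature.MathematicalPhysics.StatisticalMechanics.lennardJones 3 N / N) Filter.atTop (nhds e) → (∀ N : ℕ, 0 < N → e ≤ Literature.MathematicalPhysics.StatisticalMechanics.groundStateEnergy Literature.MathematicalPhysics.StatisticalMechanics.lennardJones 3 N / N) → ∀ Y : Set (EuclideanSpace ℝ (Fin 3)), Literature.MathematicalPhysics.StatisticalMechanics.UniformlyDiscrete Y → (∀ z : EuclideanSpace ℝ (Fin 3), ∃ w ∈ Y, dist z w ≤ 9 / 10) → Literature.MathematicalPhysics.StatisticalMechanics.IsMuGSC Literature.MathematicalPhysics.StatisticalMechanics.lennardJones e Y → ∀ b : ℝ, 47 / 50 ≤ b → b ≤ 1 → (∀ z : EuclideanSpace ℝ (Fin 3), ∃ y ∈ Y, dist z y ≤ 10 ∧ ∀ s : ℝ, 0 < s → s < 1 / 100 → ({w ∈ Y | w ≠ y ∧ dist y w ≤ b * (1 + 1 / 50) + s}.ncard = 12 ∧ (∀ w ∈ Y, w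 ≠ y → b * (1 - 1 / 50) - s ≤ dist y w ∧ (dist y w ≤ b * (1 + 1 / 50) + s ∨ b * (63 / 50) - s ≤ dist y w)) ∧ (∃ T : Finset (EuclideanSpace ℝ (Fin 3)), (↑T : Set (EuclideanSpace ℝ (Fin 3))) = (fun w => b⁻¹ • (w - y)) '' {w ∈ Y | w ≠ y ∧ dist y w ≤ b * (1 + 1 / 50)} ∧ (Literature.Geometry.DiscreteGeometry.ShellCloseTo (1 / 5 + s) T Literature.Geometry.DiscreteGeometry.fccKissingPattern ∨ Literature.Geometry.DiscreteGeometry.ShellCloseTo (1 / 5 + s) T Literature.Geometry.DiscreteGeometry.hcpKissingPattern)))) → ∀ a : ℝ, 47 / 50 ≤ a → a ≤ 1 → (∀ y ∈ Y, ({w ∈ Y | w ≠ y ∧ dist y w < a * (63 / 50) - 1 / 250}.ncard ≤ 12 ∧ 12 ≤ {w ∈ Y | w ≠ y ∧ dist y w ≤ a * (1 + 1 / 50) + 1 / 250}.ncard ∧ ∀ w ∈ Y, w ≠ y → a * (1 - 1 / 50) - 1 / 250 ≤ dist y w ∧ (dist y w ≤ a * (1 + 1 / 50) + 1 / 250 ∨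 a * (63 / 50) - 1 / 250 ≤ dist y w))) → ∀ t : ℝ, 0 < t → ∀ L : ℝ, ∃ a' : ℝ, 47 / 50 ≤ a' ∧ a' ≤ 1 ∧ ∃ q ∈ Y, ∀ y ∈ Y, dist y q ≤ L → ({w ∈ Y | w ≠ y ∧ dist y w < a' * (63 / 50) - t}.ncard ≤ 12 ∧ 12 ≤ {w ∈ Y | w ≠ y ∧ dist y w ≤ a' * (1 + 1 / 50) + t}.ncard ∧ ∀ w ∈ Y, w ≠ y → a' * (1 - 1 / 50) - t ≤ dist y w ∧ (dist y w ≤ a' * (1 + 1 / 50) + t ∨ a' * (63 / 50) - t ≤ dist y w)))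
    (hCE : CleanlessExcessT) (hR : CoherentResidual 10) : RobustDefectLimitWindows :=
  rdef_of_grossU_liouBallsU_coherent (T₀ := 1 / 250) (by norm_num) hG (cleanLiouvilleBallsU_record_iff.2 hL) hCE hR

end Summit.AtomisticToContinuum.Crystallization.Theorems.OverbindingBudgetUniformCutDensity
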